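/-
Copyright (c) 2026 the pub-hodgecm-mathlib formalisation cell (harness21).  Prover seat hodgecm-mathlib-B-p08 (g41), «(D-RAM) FOUR-FRAME» road of crux H413
(Track A, tier-1 unit U3_Laws, stub `stub_U3_edgeLaw_t2` held by LH4-p09; this file = its two geometric inputs (F)∕(N), by agreement on the LH4 bus 21:22Z); 2026-09-03.
-/
import Literature.NumberTheory.Automorphic.UnitaryLatticeTreeFixedFiniteModelTransport   -- ★ J4a `finite_setOf_latticeGraphIso_diagonal_eq` + ★ `finite_setOf_latticeGraphIso_eq_of_model` + ★ `exists_unitary_diagonal_coe_eq_diagonal`, `v_eq_one_of_mul_map_eq_one`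
import Literature.NumberTheory.Automorphic.UnitaryThreeFourFrameLiteralUnitary            -- ★ (F0P3-p01 (g30)): `formCongr_frameMatrix`, `frameElt_eq_conj_diagonal`; brings ★ `isUnit_det_frameMatrix`, `formCongr_mul_eq`, #0a `frameElt`
import Literature.NumberTheory.Automorphic.UnitaryThreeFourFrameAxisUpStep               -- ★ (B-p04 (g61)): `map_pairing_smul_frame_self` (frame norms are `σ`-fixed)
import Literature.NumberTheory.Automorphic.UnitaryLatticeTreeSeparableStableRoot           -- ★ `isSelfDualLattice_stdLattice_diagonal` (the root is self-dual for a unit diagonal form)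
import Literature.NumberTheory.Automorphic.UnitaryLatticeTreeStabilizer                    -- ★ `mapGL_stdLattice_eq_iff` (`γ·𝒪^N = 𝒪^N ↔ γ, γ⁻¹ integral`)
import HarnessLib

/-!
# The fixed vertices of a regular four-frame literal `Γ_b = frameElt σ f b α β` in the lattice graph of `(K³, Φ₃)` over a WILD (ramified) quadratic datum:
# (F) they form a FINITE set, (N) they form a NON-EMPTY set (Kottwitz 1986 §3; Rogawski 1990 §4.9 Lemma 4.9.3)

Topic `NumberTheory/Automorphic`; namespace `Literature.NumberTheory.Automorphic.UnitaryThreeFourFrame` (★ #0a `UnitaryThreeFourFrameDefs`).  THEOREMS ONLY (no `def`, no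
instance, no notation, no named fact, no `sorry`); kernel lane `--supports stmt-HodgeConjecture-24833` (count-neutral lattice bookkeeping).  Cell `pub/hodgecm-mathlib`
(D-0151), crux H413 = `stmt-HodgeConjecture-24833`, route of record `HCCMUnconditional`; «(D-RAM) FOUR-FRAME» road (director s1808, heir LEAD F0P3a-plan (g19)), tier-1
unit `Cruxes/H413/Lines/F0_P3c_DyRamFourFrame_U3_Laws.lean`, stub `stub_U3_edgeLaw_t2` («#fixed edges + 1 = #fixed vertices», a finite non-empty subtree): its holder LH4-p09
(EMIT #6) counts on the fenced wild tree by ★ `RootedTree.ncard_fixedPoints_eq_ncard_fixedEdges_add_one`, which needs exactly the two inputs of THIS file — the fixed-vertex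
set of `Γ_b` is FINITE (F) and NON-EMPTY (N) — in the vertex currency `{v | latticeGraphIso σ ϖ Φ₃ γ v = v}` (bus agreement LH4 21:20Z ∕ 21:22Z; no double staffing).

THE MATHEMATICS.  `K` a complete discretely valued field with finite residue field, `σ` an isometric involution, `ϖ` a uniformiser, and the WILD-datum clause «`σ`-fixed
non-zero elements have EVEN valuation» (★ #0a `IsRamifiedQuadraticDatum`, conjunct 4); `f` a four-frame family (★ #0a H7: each `f b` is a `Φ₃`-ORTHOGONAL frame with
non-zero norms `N_i = ⟨f_{b,i}, f_{b,i}⟩`), `α, β` norm-one and REGULAR (`α ≠ β`, `α ≠ 1`, `β ≠ 1`), `γ ∈ U(σ, Φ₃)` with matrix `Γ_b = 1 + (α−1)π₁ + (β−1)π₂`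
(★ #0a `frameElt`; unitary by ★ `exists_unitary_coe_eq_smul_frameElt`).
* §1 THE UNIMODULAR EIGENFRAME (`exists_unimodular_eigenframe`).  The norms `N_i` are `σ`-fixed (★ `map_pairing_smul_frame_self`), hence `|N_i| = exp(2n_i)`; rescaling
  the frame vectors by `c_i = ϖ^{n_i}` gives a frame matrix `A = Q_b·diag(c)` (`Q_b` = ★ frame matrix, columns `f_{b,i}`) whose Gram matrix `ᵗσ(A)Φ₃A = diag(d)` is a
  UNIT diagonal (`|d_i| = |c_i|²|N_i| = 1`; ★ `formCongr_frameMatrix` + `formCongr_mul_eq`), and still `Γ_b = A·diag(α, β, 1)·A⁻¹` (★ `frameElt_eq_conj_diagonal`;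
  diagonal matrices commute).
* §2 (F) `finite_setOf_latticeGraphIso_eq_of_frameElt`: in the unit diagonal model `diag(d)` the literal is the regular diagonal `diag(α, β, 1)` (a unitary element there,
  ★ `exists_unitary_diagonal_coe_eq_diagonal`), whose fixed vertices are finitely many by ★ J4a `finite_setOf_latticeGraphIso_diagonal_eq` (the regularity witness
  `δ = (α−β)(α−1)(β−1) ≠ 0` bounds every product of two eigenvalue differences from below); ★ `finite_setOf_latticeGraphIso_eq_of_model` (with `P = A`, `c = 1`)
  transports finiteness back to `Φ₃`.
* §3 (N) `exists_latticeGraphIso_eq_of_frameElt`: the lattice `M₀ = A·𝒪³` spanned by the rescaled frame is a (self-dual) vertex (★ `isSelfDualLattice_stdLattice_diagonal` in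
  the model + ★ `isVertex_formCongr_iff`) and `Γ_b·M₀ = A·diag(α,β,1)·𝒪³ = A·𝒪³` (a unit diagonal matrix stabilises `𝒪³`, ★ `mapGL_stdLattice_eq_iff`) — no regularity
  or finiteness of the residue field is needed here.
What is NOT here: the third input of ★ p854681 (finiteness of the `⟨γ⟩`-orbit of the root; not on LH4-p09's route), any coset currency, any count.

HONEST LABEL: count-neutral; HC_CM is proved only modulo the 7 printed citations (2 remaining: hLiu418 = stmt-HodgeConjecture-24832, h413 = stmt-HodgeConjecture-24833) until rung 0
closes; the verdict of record for (D-RAM) stays PRINT [LanglandsShelstad1989 Thm. p. 484 ∕ Rogawski1990 Prop. 4.9.1 (a)].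

## References
* [Kottwitz1986BaseChangeUnits] R. E. Kottwitz, *Base change for unit elements of Hecke algebras*, Compositio Math. 60 (1986), §3 (the fixed-point set of a regular elliptic
  element in the building is bounded), §1 pp. 240–241.
* [Rogawski1990] J. D. Rogawski, *Automorphic Representations of Unitary Groups in Three Variables*, Ann. of Math. Stud. 123 (1990), §4.9 pp. 54–55, Lemma 4.9.3; §3.6 p. 31.
* [BruhatTits1972] F. Bruhat, J. Tits, *Groupes réductifs sur un corps local I*, Publ. IHÉS 41 (1972), §10.
* [Jacobowitz1962] R. Jacobowitz, *Hermitian forms over local fields*, Amer. J. Math. 84 (1962), §4, §7.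
-/

noncomputable section

open scoped Matrix MatrixGroups Valued WithZero

namespace Literature.NumberTheory.Automorphic.UnitaryThreeFourFrame

open Literature.NumberTheory.Automorphic Literature.NumberTheory.Automorphic.UnitaryGroup Literature.NumberTheory.Automorphic.UnitaryLatticeTree
open Literature.NumberTheory.Automorphic.HermitianLattice

variable {K : Type} [Field K] [Valued K ℤᵐ⁰]

/-! ## §1  The unimodular eigenframe of a four-frame literal over a wild datum -/

/-- **THE UNIMODULAR EIGENFRAME.**  Over a wild datum (`σ` an isometric involution, `|ϖ| = exp(−1)`, `σ`-fixed non-zero elements of even valuation), every frame `f b` of a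
four-frame family can be rescaled to a frame matrix `A` (columns `ϖ^{n_i} f_{b,i}`) with UNIT DIAGONAL Gram matrix `ᵗσ(A)·Φ₃·A = diag(d)`, `|d_i| = 1`, which still
diagonalises every literal of the frame: `Γ_b(α, β) = A·diag(α, β, 1)·A⁻¹`. [cite: Jacobowitz1962, §4, §7] [cite: Rogawski1990, §3.6 p. 31] -/
theorem exists_unimodular_eigenframe {σ : K →+* K} (hσσ : ∀ a, σ (σ a) = a) (hvσ : ∀ a, Valued.v (σ a) = Valued.v a) {ϖ : K}
    (hϖ : Valued.v ϖ = WithZero.exp (-1 : ℤ)) (heven : ∀ x : K, σ x = x → x ≠ 0 → ∃ n : ℤ, Valued.v x = WithZero.exp (2 * n))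
    {f : Fin 4 → Fin 3 → (Fin 3 → K)} (hf : IsFourFrameFamily σ f) (b : Fin 4) :
    ∃ (A : GL (Fin 3) K) (d : Fin 3 → K), formCongr σ A ((StdForm.antidiagonal 3).over K) = Matrix.diagonal d ∧ (∀ i, Valued.v (d i) = 1) ∧
      ∀ α β : K, frameElt σ f b α β =
        (A : Matrix (Fin 3) (Fin 3) K) * Matrix.diagonal ![α, β, 1] * ((A⁻¹ : GL (Fin 3) K) : Matrix (Fin 3) (Fin 3) K) := by
  obtain ⟨-, hnz, -, -, -⟩ := hf b
  have hϖ0 : ϖ ≠ 0 := by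
    intro h; rw [h, map_zero] at hϖ; exact WithZero.coe_ne_zero hϖ.symm
  set Q : GL (Fin 3) K := ((Matrix.isUnit_iff_isUnit_det _).2 (isUnit_det_frameMatrix hf b)).unit with hQ_def
  have hQ : (Q : Matrix (Fin 3) (Fin 3) K) = (Matrix.of (f b))ᵀ := rfl
  -- the norms are `σ`-fixed and non-zero, hence of even valuation
  have hN : ∀ i : Fin 3, ∃ n : ℤ, Valued.v (pairing σ ((StdForm.antidiagonal 3).over K) (f b i) (f b i)) = WithZero.exp (2 * n) := fun i => by
    refine heven _ ?_ (hnz i)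
    have h := map_pairing_smul_frame_self hσσ (f b i) 1
    rwa [one_smul] at h
  choose n hn using hN
  -- the rescaling `c_i = ϖ^{n_i}`
  set c : Fin 3 → K := fun i => ϖ ^ (n i) with hc_def
  have hc0 : ∀ i, c i ≠ 0 := fun i => zpow_ne_zero _ hϖ0
  have hvc : ∀ i, Valued.v (c i) = WithZero.exp (-(n i)) := fun i => by
    rw [hc_def]
    dsimp only
    rw [map_zpow₀, hϖ, ← WithZero.exp_zsmul, smul_eq_mul, mul_neg_one]
  let C : GL (Fin 3) K :=
    ⟨Matrix.diagonal c, Matrix.diagonal fun i => (c i)⁻¹,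
      by rw [Matrix.diagonal_mul_diagonal, ← Matrix.diagonal_one]; congr 1; funext i; exact mul_inv_cancel₀ (hc0 i),
      by rw [Matrix.diagonal_mul_diagonal, ← Matrix.diagonal_one]; congr 1; funext i; exact inv_mul_cancel₀ (hc0 i)⟩
  have hC : (C : Matrix (Fin 3) (Fin 3) K) = Matrix.diagonal c := rfl
  have hCi : ((C⁻¹ : GL (Fin 3) K) : Matrix (Fin 3) (Fin 3) K) = Matrix.diagonal fun i => (c i)⁻¹ := rfl
  refine ⟨Q * C, fun i => σ (c i) * pairing σ ((StdForm.antidiagonal 3).over K) (f b i) (f b i) * c i, ?_, fun i => ?_, fun α β => ?_⟩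
  · -- the Gram matrix of the rescaled frame
    rw [formCongr_mul_eq, formCongr_frameMatrix hf b Q hQ, formCongr, hC, Matrix.diagonal_map (map_zero σ), Matrix.diagonal_transpose,
      Matrix.diagonal_mul_diagonal, Matrix.diagonal_mul_diagonal]
  · -- `|σ(c_i) N_i c_i| = exp(−n_i) · exp(2n_i) · exp(−n_i) = 1`
    rw [map_mul, map_mul, hvσ, hvc, hn, ← WithZero.exp_add, ← WithZero.exp_add, ← WithZero.exp_zero]
    congr 1; ring
  · -- `Γ_b = Q·D·Q⁻¹ = (QC)·D·(QC)⁻¹` since `C D C⁻¹ = D`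
    have hCDC : Matrix.diagonal c * Matrix.diagonal ![α, β, 1] * Matrix.diagonal (fun i => (c i)⁻¹) = Matrix.diagonal ![α, β, 1] := by
      rw [Matrix.diagonal_mul_diagonal, Matrix.diagonal_mul_diagonal]
      congr 1; funext i; rw [mul_comm (c i), mul_assoc, mul_inv_cancel₀ (hc0 i), mul_one]
    rw [frameElt_eq_conj_diagonal hf b α β Q hQ, mul_inv_rev, Units.val_mul, Units.val_mul, hC, hCi]
    rw [show (Q : Matrix (Fin 3) (Fin 3) K) * Matrix.diagonal c * Matrix.diagonal ![α, β, 1] *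
        (Matrix.diagonal (fun i => (c i)⁻¹) * ((Q⁻¹ : GL (Fin 3) K) : Matrix (Fin 3) (Fin 3) K)) =
        (Q : Matrix (Fin 3) (Fin 3) K) * (Matrix.diagonal c * Matrix.diagonal ![α, β, 1] * Matrix.diagonal (fun i => (c i)⁻¹)) *
          ((Q⁻¹ : GL (Fin 3) K) : Matrix (Fin 3) (Fin 3) K) by simp only [Matrix.mul_assoc], hCDC]

/-! ## §2  (F) The fixed vertices of a regular four-frame literal form a finite set -/

/-- **(F) FINITENESS OF THE FIXED-VERTEX SET OF A REGULAR FOUR-FRAME LITERAL** over a wild datum with finite residue field: for `γ ∈ U(σ, Φ₃)` with matrix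
`frameElt σ f b α β`, `α, β` norm-one, `α ≠ β`, `α ≠ 1`, `β ≠ 1`, the set `{v | γ·v = v}` of `γ`-fixed vertices of the lattice graph of `(K³, Φ₃)` is FINITE — ★ J4a in
the unit diagonal model of §1, transported by ★ `finite_setOf_latticeGraphIso_eq_of_model`. [cite: Kottwitz1986BaseChangeUnits, §3]
[cite: Rogawski1990, §4.9 pp. 54–55, Lemma 4.9.3] [cite: BruhatTits1972, §10] -/
theorem finite_setOf_latticeGraphIso_eq_of_frameElt [Finite 𝓀[K]] {σ : K →+* K} (hσσ : ∀ a, σ (σ a) = a) (hvσ : ∀ a, Valued.v (σ a) = Valued.v a) {ϖ : K}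
    (hϖ : Valued.v ϖ = WithZero.exp (-1 : ℤ)) (heven : ∀ x : K, σ x = x → x ≠ 0 → ∃ n : ℤ, Valued.v x = WithZero.exp (2 * n))
    {f : Fin 4 → Fin 3 → (Fin 3 → K)} (hf : IsFourFrameFamily σ f) (b : Fin 4) {α β : K} (hα : α * σ α = 1) (hβ : β * σ β = 1)
    (hαβ : α ≠ β) (hα1 : α ≠ 1) (hβ1 : β ≠ 1)
    (γ : unitaryGroupOfForm σ ((StdForm.antidiagonal 3).over K)) (hγ : ((γ : GL (Fin 3) K) : Matrix (Fin 3) (Fin 3) K) = frameElt σ f b α β) :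
    {v : {M : Submodule 𝒪[K] (Fin 3 → K) // IsVertex σ ϖ ((StdForm.antidiagonal 3).over K) M} |
      latticeGraphIso σ ϖ ((StdForm.antidiagonal 3).over K) γ v = v}.Finite := by
  obtain ⟨A, d, hA, hd, hconj⟩ := exists_unimodular_eigenframe hσσ hvσ hϖ heven hf b
  have hsσ : ∀ i, (![α, β, 1] : Fin 3 → K) i * σ ((![α, β, 1] : Fin 3 → K) i) = 1 := by
    intro i; fin_cases i
    · exact hα
    · exact hβ
    · simp
  obtain ⟨T, hT⟩ := exists_unitary_diagonal_coe_eq_diagonal (σ := σ) d (![α, β, 1]) hsσ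
  have hγT : (γ : GL (Fin 3) K) = A * (T : GL (Fin 3) K) * A⁻¹ :=
    Units.ext (by rw [Units.val_mul, Units.val_mul, hT, hγ]; exact hconj α β)
  -- the inputs of ★ J4a: `|s_l| ≤ 1` and the regularity witness `δ = (α−β)(α−1)(β−1)`
  have hvα : Valued.v α = 1 := UnitaryLatticeTree.v_eq_one_of_mul_map_eq_one hvσ hα
  have hvβ : Valued.v β = 1 := UnitaryLatticeTree.v_eq_one_of_mul_map_eq_one hvσ hβ
  have hs : ∀ l, Valued.v ((![α, β, 1] : Fin 3 → K) l) ≤ 1 := by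
    intro l; fin_cases l
    · exact hvα.le
    · exact hvβ.le
    · simp
  have hδ0 : (α - β) * ((α - 1) * (β - 1)) ≠ 0 :=
    mul_ne_zero (sub_ne_zero.2 hαβ) (mul_ne_zero (sub_ne_zero.2 hα1) (sub_ne_zero.2 hβ1))
  have hA1 : Valued.v (α - β) ≤ 1 := (Valuation.map_sub _ _ _).trans (max_le hvα.le hvβ.le)
  have hB1 : Valued.v (α - 1) ≤ 1 := (Valuation.map_sub _ _ _).trans (max_le hvα.le (Valuation.map_one _).le)
  have hC1 : Valued.v (β - 1) ≤ 1 := (Valuation.map_sub _ _ _).trans (max_le hvβ.le (Valuation.map_one _).le)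
  have hvδ : Valued.v ((α - β) * ((α - 1) * (β - 1))) = Valued.v (α - β) * Valued.v (α - 1) * Valued.v (β - 1) := by
    rw [map_mul, map_mul, mul_assoc]
  have hBA : Valued.v (β - α) = Valued.v (α - β) := Valuation.map_sub_swap _ _ _
  have h1A : Valued.v (1 - α) = Valued.v (α - 1) := Valuation.map_sub_swap _ _ _
  have h1B : Valued.v (1 - β) = Valued.v (β - 1) := Valuation.map_sub_swap _ _ _
  -- the six products of two differences dominate `|δ|`
  have kAB : Valued.v ((α - β) * ((α - 1) * (β - 1))) ≤ Valued.v ((α - β) * (α - 1)) := by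
    rw [hvδ, map_mul]; exact mul_le_of_le_one_right' hC1
  have kBA : Valued.v ((α - β) * ((α - 1) * (β - 1))) ≤ Valued.v ((α - 1) * (α - β)) := by
    rw [show (α - 1) * (α - β) = (α - β) * (α - 1) from mul_comm _ _]; exact kAB
  have kAC : Valued.v ((α - β) * ((α - 1) * (β - 1))) ≤ Valued.v ((β - α) * (β - 1)) := by
    rw [hvδ, map_mul, hBA, mul_assoc, mul_comm (Valued.v (α - 1)), ← mul_assoc]; exact mul_le_of_le_one_right' hB1
  have kCA : Valued.v ((α - β) * ((α - 1) * (β - 1))) ≤ Valued.v ((β - 1) * (β - α)) := by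
    rw [mul_comm (β - 1)]; exact kAC
  have kBC : Valued.v ((α - β) * ((α - 1) * (β - 1))) ≤ Valued.v ((1 - α) * (1 - β)) := by
    rw [hvδ, map_mul, h1A, h1B, mul_assoc]; exact mul_le_of_le_one_left' hA1
  have kCB : Valued.v ((α - β) * ((α - 1) * (β - 1))) ≤ Valued.v ((1 - β) * (1 - α)) := by
    rw [mul_comm (1 - β)]; exact kBC
  have hδ : ∀ i j k : Fin 3, i ≠ j → i ≠ k → j ≠ k →
      Valued.v ((α - β) * ((α - 1) * (β - 1))) ≤ Valued.v (((![α, β, 1] : Fin 3 → K) i - (![α, β, 1] : Fin 3 → K) j) *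
        ((![α, β, 1] : Fin 3 → K) i - (![α, β, 1] : Fin 3 → K) k)) := by
    intro i j k hij hik hjk
    fin_cases i <;> fin_cases j <;> fin_cases k
    all_goals (first | exact absurd rfl hij | exact absurd rfl hik | exact absurd rfl hjk | skip)
    all_goals simp only [Fin.zero_eta, Fin.mk_one, Fin.reduceFinMk, Matrix.cons_val_zero, Matrix.cons_val_one, Matrix.cons_val_two,
      Matrix.head_cons, Matrix.tail_cons]
    all_goals first | exact kAB | exact kBA | exact kAC | exact kCA | exact kBC | exact kCB
  exact finite_setOf_latticeGraphIso_eq_of_model σ ϖ (c := (1 : K)) (map_one _) _ A (by rw [one_smul, hA]) γ T hγT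
    (finite_setOf_latticeGraphIso_diagonal_eq hvσ hϖ hd hs hδ0 hδ T hT)

/-! ## §3  (N) The fixed-vertex set of a four-frame literal is non-empty -/

/-- **(N) A FOUR-FRAME LITERAL FIXES A VERTEX**: for `γ ∈ U(σ, Φ₃)` with matrix `frameElt σ f b α β` (`α, β` norm-one; no regularity, no finiteness of the residue field
needed) the lattice `M₀ = A·𝒪³` of the unimodular eigenframe of §1 is a self-dual vertex with `γ·M₀ = M₀`. [cite: Kottwitz1986BaseChangeUnits, §3]
[cite: Rogawski1990, §4.9 pp. 54–55] [cite: Jacobowitz1962, §7] -/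
theorem exists_latticeGraphIso_eq_of_frameElt {σ : K →+* K} (hσσ : ∀ a, σ (σ a) = a) (hvσ : ∀ a, Valued.v (σ a) = Valued.v a) {ϖ : K}
    (hϖ : Valued.v ϖ = WithZero.exp (-1 : ℤ)) (heven : ∀ x : K, σ x = x → x ≠ 0 → ∃ n : ℤ, Valued.v x = WithZero.exp (2 * n))
    {f : Fin 4 → Fin 3 → (Fin 3 → K)} (hf : IsFourFrameFamily σ f) (b : Fin 4) {α β : K} (hα : α * σ α = 1) (hβ : β * σ β = 1)
    (γ : unitaryGroupOfForm σ ((StdForm.antidiagonal 3).over K)) (hγ : ((γ : GL (Fin 3) K) : Matrix (Fin 3) (Fin 3) K) = frameElt σ f b α β) :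
    ∃ v : {M : Submodule 𝒪[K] (Fin 3 → K) // IsVertex σ ϖ ((StdForm.antidiagonal 3).over K) M},
      latticeGraphIso σ ϖ ((StdForm.antidiagonal 3).over K) γ v = v := by
  obtain ⟨A, d, hA, hd, hconj⟩ := exists_unimodular_eigenframe hσσ hvσ hϖ heven hf b
  have hsσ : ∀ i, (![α, β, 1] : Fin 3 → K) i * σ ((![α, β, 1] : Fin 3 → K) i) = 1 := by
    intro i; fin_cases i
    · exact hα
    · exact hβ
    · simp
  obtain ⟨T, hT⟩ := exists_unitary_diagonal_coe_eq_diagonal (σ := σ) d (![α, β, 1]) hsσ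
  have hγT : (γ : GL (Fin 3) K) = A * (T : GL (Fin 3) K) * A⁻¹ :=
    Units.ext (by rw [Units.val_mul, Units.val_mul, hT, hγ]; exact hconj α β)
  have hϖ1 : Valued.v ϖ ≤ 1 := by rw [hϖ, ← WithZero.exp_zero, WithZero.exp_le_exp]; omega
  -- `M₀ = A·𝒪³` is a (self-dual) vertex
  have hroot : IsVertex σ ϖ (formCongr σ A ((StdForm.antidiagonal 3).over K)) (stdLattice K 3) := by
    rw [hA]; exact ⟨0, isSelfDualLattice_stdLattice_diagonal σ hϖ1 hd⟩
  have hv₀ : IsVertex σ ϖ ((StdForm.antidiagonal 3).over K) (mapGL A (stdLattice K 3)) := (isVertex_formCongr_iff A _ _).1 hroot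
  -- the unit diagonal `T = diag(α, β, 1)` stabilises `𝒪³`
  have hvs : ∀ i, Valued.v ((![α, β, 1] : Fin 3 → K) i) = 1 := by
    intro i; fin_cases i
    · exact UnitaryLatticeTree.v_eq_one_of_mul_map_eq_one hvσ hα
    · exact UnitaryLatticeTree.v_eq_one_of_mul_map_eq_one hvσ hβ
    · simp
  have hTinv : (((T : GL (Fin 3) K)⁻¹ : GL (Fin 3) K) : Matrix (Fin 3) (Fin 3) K) = Matrix.diagonal fun i => σ ((![α, β, 1] : Fin 3 → K) i) := by
    apply Units.inv_eq_of_mul_eq_one_right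
    rw [hT, Matrix.diagonal_mul_diagonal, ← Matrix.diagonal_one]
    congr 1; funext i; exact hsσ i
  have hTstd : mapGL (T : GL (Fin 3) K) (stdLattice K 3) = stdLattice K 3 := by
    refine (mapGL_stdLattice_eq_iff _).2 ⟨fun i j => ?_, fun i j => ?_⟩
    · rw [hT, Matrix.diagonal_apply]
      split_ifs
      · exact (hvs i).le
      · rw [map_zero]; exact zero_le_one
    · rw [hTinv, Matrix.diagonal_apply]
      split_ifs
      · rw [hvσ]; exact (hvs i).le
      · rw [map_zero]; exact zero_le_one
  refine ⟨⟨mapGL A (stdLattice K 3), hv₀⟩, Subtype.ext ?_⟩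
  change mapGL (γ : GL (Fin 3) K) (mapGL A (stdLattice K 3)) = mapGL A (stdLattice K 3)
  rw [hγT, mapGL_mul, mapGL_mul, mapGL_inv_mapGL, hTstd]

end Literature.NumberTheory.Automorphic.UnitaryThreeFourFrame

end
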